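import Summits.ValiantsHypothesis.ValiantsHypothesis.Theses.FermionicJet
import Summits.ValiantsHypothesis.ValiantsHypothesis.Theorems.FermionicJetQuadraticDcCdetKernelStd
import Summits.ValiantsHypothesis.ValiantsHypothesis.Theorems.FermionicJetQuadraticDcCdetSmallThree
import Summits.ValiantsHypothesis.ValiantsHypothesis.Theorems.FermionicJetQuadraticDcCdetSmallFour

/-!
# Route `FermionicJet`, crux `QuadraticDcCdet` (stmt-ValiantsHypothesis-5343) — PROVED

**Statement.** For every `n ≥ 3`, `n² ≤ 2 · dc(cdet_n)`, where
`cdet_n = Σ_σ sgn σ · c(σ) · ∏ᵢ X_{σ i, i}` is the cycle-counting determinant (`c(σ)` = number of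
cycles, fixed points included) and `dc` the determinantal complexity over `ℂ`.  Since
`dc(det_n) = n`, this is a Mignon–Ressayre-size separation of the first jet of the fermionic pencil
from the determinant.

**Proof.** By the cone fact `rank Hess_x(f) ≤ 2·dc(f)` at zeros `x` of `f`
(`rank_hessianMatrix_le_two_mul_determinantalComplexity`, Mignon–Ressayre) it suffices to exhibit a
zero of `cdet_n` with nonsingular `n² × n²` Hessian.  NEW EXPLICIT FAMILY: the all-ones matrix `J`
with ONE off-diagonal entry replaced by `3 - n` is a zero of `cdet_n` for every `n`
(`cdet(J + sE_{pq}) = (-1)^{n} (n-3)! (n - 2 + s)`, helper 3), and its Hessian is, up to the unit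
`(-1)^n (n-5)!`, the integer pattern matrix
`-(n-4) ε(a,b,c,d) + (n-2) [q ∉ {b,d}] [p ∉ {a,c}] ε(ρa, b, ρc, d)` (`ε = ±1` the equality pattern of
the two prescribed arcs, `ρ` the contraction of the arc `q → p`; helpers 1–3), which has trivial
kernel for all `n ≥ 5` by an `𝔖_{n-2}`-equivariant elimination with exact polynomial certificates
(helpers 4, 5a, 5b: invariant `10 × 10` block of determinant `-8(n-1)²(n-3)⁴(2n-7)(n-4)⁸`, standard
`7 × 7` block of determinant `-8(n-4)⁴(n⁴-12n³+51n²-86n+39)`, local `2 × 2` blocks).  The cases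
`n = 3` (point `J + E_{11}`) and `n = 4` are explicit `9 × 9` / `16 × 16` certificates (helpers 3b,
6, 6b).  For `n ≥ 5` the computation runs on the index type `Option (Option (Fin (n-5+3)))` and is
transported to `Fin n` by relabelling (`cdetPoly` is natural under index bijections; `dc` is
monotone under projections).

HONEST FRAMING: a quadratic lower bound `dc(cdet_n) ≥ n²/2` for a dormant route's crux polynomial,
proved by the classical Hessian-rank method at a new explicit point; `VP ≠ VNP` is NOT proved and
nothing here is progress on it beyond this route-internal step.
-/

noncomputable section

open MvPolynomial Equiv Equiv.Perm Finset

-- layout Summits/ValiantsHypothesis/ValiantsHypothesis forces the duplicated namespace component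
set_option linter.dupNamespace false

namespace Summit.ValiantsHypothesis.ValiantsHypothesis.Theorems.FermionicJet.CdetHessian

open Literature.Computability.AlgebraicComplexity

universe u v w

/-! ### Relabelling the indices of `cdet` -/

/-- `cdetPoly` is natural under bijections of the index type. -/
theorem rename_cdetPoly_equiv {k : Type u} [CommRing k] {ι : Type v} {ι' : Type w} [Fintype ι]
    [DecidableEq ι] [Fintype ι'] [DecidableEq ι'] (e : ι ≃ ι') :
    rename (Prod.map e e) (cdetPoly ι k) = cdetPoly ι' k := by
  rw [cdetPoly, cdetPoly, map_sum]
  refine Fintype.sum_equiv (Equiv.permCongr e) _ _ (fun σ => ?_)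
  rw [map_mul, rename_C, map_prod, Perm.sign_permCongr,
    Literature.Computability.AlgebraicComplexity.DeRugyAltherre.numCycles_permCongr]
  congr 1
  refine Fintype.prod_equiv e _ _ (fun i => ?_)
  rw [rename_X]
  simp [Equiv.permCongr_apply]

/-- `dc` of `cdetPoly` does not increase under relabelling: `dc(cdet_ι) ≤ dc(cdet_{ι'})` for
equinumerous index types (a relabelling is a projection). -/
theorem determinantalComplexity_cdetPoly_le_of_equiv {k : Type u} [Field k] {ι : Type v}
    {ι' : Type w} [Fintype ι] [DecidableEq ι] [Fintype ι'] [DecidableEq ι'] (e : ι' ≃ ι) :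
    determinantalComplexity (cdetPoly ι k) ≤ determinantalComplexity (cdetPoly ι' k) := by
  have hproj : IsProjection (cdetPoly ι k) (cdetPoly ι' k) := by
    refine ⟨fun x => X (Prod.map e e x), fun i => Or.inl ⟨_, rfl⟩, ?_⟩
    rw [← rename_cdetPoly_equiv (k := k) e, MvPolynomial.rename_eq_aeval]
    rfl
  exact determinantalComplexity_le_of_isProjection_holds hproj

/-! ### The closed-form Hessian entry versus the pattern matrix (`n ≥ 5`) -/

/-- Pointwise comparison of the Hessian entry (helper 3, `m ≥ 2`) with the pattern entry
`C · (α ε + β [..] ε∘ρ)`, given the two scalar relations between the cycle sums and `C`. -/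
theorem hessEntry_eq_mul_pattern {K : Type u} [CommRing K] {ι : Type v} [DecidableEq ι]
    {m : ℕ} (hm1 : ¬ (m + 1 ≤ 1)) (hm : ¬ (m ≤ 1)) (p q a b c d : ι) (s C α β : K)
    (hX : (-1) ^ (m + 1) * ((m + 1 - 2).factorial : K) = α * C)
    (hY : s * ((-1) ^ m * ((m - 2).factorial : K)) = -(β * C)) :
    (if b = d then 0 else if a = c then 0 else
        (if (a = b ∧ c = d) ∨ ¬((a = b ∨ c = d) ∨ (a = d ∧ c = b)) then (1 : K) else -1) *
            (if m + 1 ≤ 1 then ((m + 1 : ℕ) : K) else (-1) ^ (m + 1) * ((m + 1 - 2).factorial : K)) +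
          (if a = b ∧ c = d then (2 : K) else if (a = b ∨ c = d) ∨ (a = d ∧ c = b) then -1
            else 0) * (if m + 1 ≤ 1 then (1 : K) else 0)) +
      s * (if b = d ∨ q = b ∨ q = d then 0 else if a = p ∨ c = p then 0 else
        -(if (if a = q then p else a) = (if c = q then p else c) then 0 else
          (if ((if a = q then p else a) = b ∧ (if c = q then p else c) = d) ∨
              ¬(((if a = q then p else a) = b ∨ (if c = q then p else c) = d) ∨
                ((if a = q then p else a) = d ∧ (if c = q then p else c) = b)) then (1 : K)
            else -1) * (if m ≤ 1 then (m : K) else (-1) ^ m * ((m - 2).factorial : K)) +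
          (if (if a = q then p else a) = b ∧ (if c = q then p else c) = d then (2 : K)
            else if ((if a = q then p else a) = b ∨ (if c = q then p else c) = d) ∨
              ((if a = q then p else a) = d ∧ (if c = q then p else c) = b) then -1 else 0) *
            (if m ≤ 1 then (1 : K) else 0))) =
    C * (if b = d ∨ a = c then 0 else
      α * (if (a = b ∧ c = d) ∨ ¬((a = b ∨ c = d) ∨ (a = d ∧ c = b)) then (1 : K) else -1) +
      β * (if q = b ∨ q = d ∨ a = p ∨ c = p then 0 else
        if (if a = q then p else a) = (if c = q then p else c) then 0 else
        (if ((if a = q then p else a) = b ∧ (if c = q then p else c) = d) ∨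
          ¬(((if a = q then p else a) = b ∨ (if c = q then p else c) = d) ∨
            ((if a = q then p else a) = d ∧ (if c = q then p else c) = b)) then (1 : K) else -1))) := by
  rw [if_neg hm1, if_neg hm1, if_neg hm, if_neg hm, hX]
  generalize ((-1 : K) ^ m * ((m - 2).factorial : K)) = Y at hY ⊢
  grind (splits := 40)

/-! ### The main theorem -/

/-- **`n² ≤ 2·dc(cdet_n)` for `n ≥ 5`**, on the index type `Option (Option (Fin (k+3)))`. -/
theorem sq_le_two_mul_dc_cdetPoly_option (k : ℕ) :
    (k + 5) ^ 2 ≤ 2 * determinantalComplexity (cdetPoly (Option (Option (Fin (k + 3)))) ℂ) := by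
  set ι := Option (Option (Fin (k + 3))) with hιdef
  have hι : Fintype.card ι = (k + 2) + 3 := by simp [hιdef]
  have hpq : (none : ι) ≠ some none := by simp
  set x : ι × ι → ℂ := fun ij => if ij = ((none : ι), (some none : ι)) then
    1 + (-(((k + 2 : ℕ) : ℂ) + 1)) else (1 : ℂ) with hx
  have hx0 : eval x (cdetPoly ι ℂ) = 0 := eval_cdetPoly_onePlus_eq_zero hι hpq
  -- the pattern matrix
  set M : Matrix (ι × ι) (ι × ι) ℂ := Matrix.of fun (z : ι × ι) (y : ι × ι) =>
    if y.2 = z.2 ∨ y.1 = z.1 then (0 : ℂ) else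
      (-((k : ℂ) + 1)) * (if (y.1 = y.2 ∧ z.1 = z.2) ∨ ¬((y.1 = y.2 ∨ z.1 = z.2) ∨
          (y.1 = z.2 ∧ z.1 = y.2)) then (1 : ℂ) else -1) +
      ((k : ℂ) + 3) * (if (some none : ι) = y.2 ∨ (some none : ι) = z.2 ∨ y.1 = none ∨ z.1 = none
          then 0 else
        if (if y.1 = some none then none else y.1) = (if z.1 = some none then none else z.1) then 0
        else
        (if ((if y.1 = some none then none else y.1) = y.2 ∧
              (if z.1 = some none then none else z.1) = z.2) ∨
            ¬(((if y.1 = some none then none else y.1) = y.2 ∨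
                (if z.1 = some none then none else z.1) = z.2) ∨
              ((if y.1 = some none then none else y.1) = z.2 ∧
                (if z.1 = some none then none else z.1) = y.2)) then (1 : ℂ) else -1)) with hMdef
  have hM : ∀ a b c d : ι, M (c, d) (a, b) = if b = d ∨ a = c then 0 else
      (-((k : ℂ) + 1)) * (if (a = b ∧ c = d) ∨ ¬((a = b ∨ c = d) ∨ (a = d ∧ c = b)) then (1 : ℂ)
        else -1) +
      ((k : ℂ) + 3) * (if (some none : ι) = b ∨ (some none : ι) = d ∨ a = none ∨ c = none then 0
        else
        if (if a = some none then none else a) = (if c = some none then none else c) then 0 else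
        (if ((if a = some none then none else a) = b ∧ (if c = some none then none else c) = d) ∨
          ¬(((if a = some none then none else a) = b ∨ (if c = some none then none else c) = d) ∨
            ((if a = some none then none else a) = d ∧ (if c = some none then none else c) = b))
          then (1 : ℂ) else -1)) := fun a b c d => rfl
  -- Hessian = C • M
  have hC : ((-1 : ℂ) ^ (k + 2) * (k.factorial : ℂ)) ≠ 0 :=
    mul_ne_zero (pow_ne_zero _ (by norm_num)) (by exact_mod_cast Nat.factorial_ne_zero k)
  have hH : hessianMatrix (cdetPoly ι ℂ) x = ((-1 : ℂ) ^ (k + 2) * (k.factorial : ℂ)) • M := by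
    ext ⟨c, d⟩ ⟨a, b⟩
    rw [hx, hessianMatrix_cdetPoly_onePlus_apply hι hpq, Matrix.smul_apply, hM, smul_eq_mul]
    refine hessEntry_eq_mul_pattern (by omega) (by omega) none (some none) a b c d _ _ _ _ ?_ ?_
    · rw [show k + 2 + 1 - 2 = k + 1 from by omega, Nat.factorial_succ, pow_succ]; push_cast; ring
    · rw [show k + 2 - 2 = k from by omega]; push_cast; ring
  -- M is injective
  have hinj : Function.Injective M.mulVec := by
    intro v w hvw
    have h0 : M.mulVec (v - w) = 0 := by rw [Matrix.mulVec_sub, hvw, sub_self]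
    have hz := patternMulVec_eq_zero_imp (K := ℂ) k (Fintype.card_fin (k + 3)) (v - w)
      (fun c d => by
        rw [← patternMulVec_apply hpq (-((k : ℂ) + 1)) ((k : ℂ) + 3) M hM (v - w) c d, h0]
        rfl)
    exact sub_eq_zero.mp hz
  have hrank : (hessianMatrix (cdetPoly ι ℂ) x).rank = (k + 5) ^ 2 := by
    rw [hH, rank_smul_eq hC, Matrix.rank_of_isUnit _ (Matrix.mulVec_injective_iff_isUnit.mp hinj),
      Fintype.card_prod, hι]
    ring
  have hle := rank_hessianMatrix_le_two_mul_determinantalComplexity (cdetPoly ι ℂ) x hx0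
  rw [hrank] at hle
  exact hle

/-- **`3² ≤ 2·dc(cdet₃)`** (point `[[2,1,1],[1,1,1],[1,1,1]]`). -/
theorem sq_le_two_mul_dc_cdetPoly_three :
    3 ^ 2 ≤ 2 * determinantalComplexity (cdetPoly (Fin 3) ℂ) := by
  set x : Fin 3 × Fin 3 → ℂ := fun ij => if ij = ((0 : Fin 3), (0 : Fin 3)) then
    1 + (((0 : ℕ) : ℂ) + 1) else (1 : ℂ) with hx
  have hι : Fintype.card (Fin 3) = 0 + 3 := by simp
  have hx0 : eval x (cdetPoly (Fin 3) ℂ) = 0 := eval_cdetPoly_diagPlus_eq_zero hι 0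
  have hinj : Function.Injective (hessianMatrix (cdetPoly (Fin 3) ℂ) x).mulVec := by
    intro v w hvw
    have h0 : (hessianMatrix (cdetPoly (Fin 3) ℂ) x).mulVec (v - w) = 0 := by
      rw [Matrix.mulVec_sub, hvw, sub_self]
    exact sub_eq_zero.mp (hessian_mulVec_eq_zero_imp_three (v - w) h0)
  have hrank : (hessianMatrix (cdetPoly (Fin 3) ℂ) x).rank = 3 ^ 2 := by
    rw [Matrix.rank_of_isUnit _ (Matrix.mulVec_injective_iff_isUnit.mp hinj), Fintype.card_prod,
      Fintype.card_fin]
    norm_num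
  have hle := rank_hessianMatrix_le_two_mul_determinantalComplexity (cdetPoly (Fin 3) ℂ) x hx0
  rw [hrank] at hle
  exact hle

/-- **`4² ≤ 2·dc(cdet₄)`** (all-ones point with `(0,1)` entry `-1`). -/
theorem sq_le_two_mul_dc_cdetPoly_four :
    4 ^ 2 ≤ 2 * determinantalComplexity (cdetPoly (Fin 4) ℂ) := by
  set x : Fin 4 × Fin 4 → ℂ := fun ij => if ij = ((0 : Fin 4), (1 : Fin 4)) then
    1 + (-(((1 : ℕ) : ℂ) + 1)) else (1 : ℂ) with hx
  have hι : Fintype.card (Fin 4) = 1 + 3 := by simp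
  have hpq : (0 : Fin 4) ≠ 1 := by decide
  have hx0 : eval x (cdetPoly (Fin 4) ℂ) = 0 := eval_cdetPoly_onePlus_eq_zero hι hpq
  have hinj : Function.Injective (hessianMatrix (cdetPoly (Fin 4) ℂ) x).mulVec := by
    intro v w hvw
    have h0 : (hessianMatrix (cdetPoly (Fin 4) ℂ) x).mulVec (v - w) = 0 := by
      rw [Matrix.mulVec_sub, hvw, sub_self]
    exact sub_eq_zero.mp (hessian_mulVec_eq_zero_imp_four (v - w) h0)
  have hrank : (hessianMatrix (cdetPoly (Fin 4) ℂ) x).rank = 4 ^ 2 := by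
    rw [Matrix.rank_of_isUnit _ (Matrix.mulVec_injective_iff_isUnit.mp hinj), Fintype.card_prod,
      Fintype.card_fin]
    norm_num
  have hle := rank_hessianMatrix_le_two_mul_determinantalComplexity (cdetPoly (Fin 4) ℂ) x hx0
  rw [hrank] at hle
  exact hle

/-- **`n² ≤ 2·dc(cdet_n)` for all `n ≥ 3`**, on `Fin n`. -/
theorem sq_le_two_mul_determinantalComplexity_cdetPoly (n : ℕ) (hn : 3 ≤ n) :
    n ^ 2 ≤ 2 * determinantalComplexity (cdetPoly (Fin n) ℂ) := by
  rcases Nat.lt_or_ge n 5 with h | h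
  · interval_cases n
    · exact sq_le_two_mul_dc_cdetPoly_three
    · exact sq_le_two_mul_dc_cdetPoly_four
  · obtain ⟨k, rfl⟩ : ∃ k, n = k + 5 := ⟨n - 5, by omega⟩
    have e : Fin (k + 5) ≃ Option (Option (Fin (k + 3))) :=
      Fintype.equivOfCardEq (by simp)
    exact (sq_le_two_mul_dc_cdetPoly_option k).trans
      (Nat.mul_le_mul_left 2 (determinantalComplexity_cdetPoly_le_of_equiv e))

end Summit.ValiantsHypothesis.ValiantsHypothesis.Theorems.FermionicJet.CdetHessian

namespace Summit.ValiantsHypothesis.ValiantsHypothesis.Theorems.FermionicJet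

/-- **Crux `QuadraticDcCdet` of route `FermionicJet` (stmt-ValiantsHypothesis-5343), PROVED**:
for every `n ≥ 3`, `n² ≤ 2 · dc(cdet_n)` over `ℂ`. -/
theorem quadraticDcCdet_proof :
    Summit.ValiantsHypothesis.ValiantsHypothesis.Theses.FermionicJet.QuadraticDcCdet := by
  intro n hn
  exact CdetHessian.sq_le_two_mul_determinantalComplexity_cdetPoly n hn

end Summit.ValiantsHypothesis.ValiantsHypothesis.Theorems.FermionicJet
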